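import Summits.BirchSwinnertonDyer.BirchSwinnertonDyer.Theorems.ByReductionTypeAtTwoOrdKatoHalfAtTwoIsoKatoIntSignFreeDoor
import Summits.BirchSwinnertonDyer.BirchSwinnertonDyer.Theorems.ByReductionTypeAtTwoOrdKatoHalfAtTwoIsoOptimalOff514OptimalMember
import HarnessLib

/-!
# Route ByReductionTypeAtTwo, crux `OrdKatoHalfAtTwoIso` (stmt-BirchSwinnertonDyer-19573), child B7′
# (stmt-BirchSwinnertonDyer-23921): the `μ`-door WITH SLACK — `μ(X(E/ℚ_∞)) ≤ μ(G)` from a span-free Coleman package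
# and `Sel₀(E/ℚ_∞)[2]` finite, for ANY image of `ρ̄₂` — and B7′ BY NAME from {Coleman package, Conjecture A₂} AT THE
# OPTIMAL MEMBER (theorems only)

Seat `cruxlead-stmt-BirchSwinnertonDyer-19573-w2` GEN 3 (prover WIDTH under LEAD cruxlead-19573 g5; HOME
`run/shared/lean/pub/bsd-2adic/`; `--supports` stmt-BirchSwinnertonDyer-23921; pen RC-386 (iii)/RC-387 «B7′ lane: C₃ first, then
the 2-group images»). HONEST FRAMING (cell bsd-2adic): BSD is not proved by any of this; neither the crux nor B7′ is proved
here; THEOREMS ONLY — the beyond-print inputs are written INLINE as displayed hypotheses (no definition, no named fact,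
nothing asserted); every door is CONDITIONAL on them.

WHY THIS FILE («then the 2-group images»). On the `E[2]`-REDUCIBLE part of B7′'s habitat the analytic `μ` at the optimal
curve `E₀` can be POSITIVE (Greenberg LNM 1716 p. 170; `N = 15`: `μ(E₀) = 1`), so the `μ = 0` door of the `C₃` file does not
apply; what B7′ asks there (optimal-member form, p692385 `katoMuPartOff514_of_optimalMember`) is Kato's `μ`-PART
`X5.O1.KatoMuPartAtTwo W₀`: `2^{μ(X(W₀/ℚ_∞))} ∣ L₀` for every integral lift `L₀` of `ϖ·L₂(f, α)`. The same span-free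
bookkeeping gives it WITH SLACK: from an ideal `P ⊆ Λ`, `M ⊆ P` killed by `τ : P → X`, `π : X ↠ X₀` exact after `τ`, ONE
element `s·G ∈ M` with `s ∉ (2)`, `G ≠ 0`, and `Sel₀(E/ℚ_∞)[2]` finite:
`length_(2) X ≤ length_(2)(Λ/(s·G)) + length_(2) X₀ = μ(G) + 0`, where `μ(G)` is the exact power of `2` dividing `G` in `Λ`
(`X1.MuLambda.mu`; `length_(2)(Λ/(G)) = μ(G)` by `G = 2^{μ(G)}·G♭` with `G♭ ∉ (2)`, `lengthAt_quotient_C_pow`). Hence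
`2^{μ(X)} ∣ 2^{μ(G)} ∣ G ∣ L₀` whenever `L₀ = ϖ₀·G` with `ϖ₀ ∈ ℤ₂` — which is the case at every member where `ord₂ ϖ ≥ 0`,
in particular at every LATTICE-OPTIMAL member (p692385 `padicValRat_two_neronRatio_eq_zero_of_latticeOptimal_of_abbesUllmo`,
Abbes–Ullmo BY NAME). No image hypothesis, no analytic `μ = 0`, no Euler-system genuineness, no core Theorem A.

* `lengthAt_augIdealP_quotient_span_singleton_eq_mu` — `length_(p)(Λ/(G)) = μ(G)` for `G ≠ 0` (any prime `p`).
* `mu_le_mu_of_unitMultiple_of_exact_of_finite_fineSelmer_pTorsion` — **the `μ`-door WITH SLACK (KERNEL)**: `μ(X) ≤ μ(G)`.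
* `katoMuPartAtTwo_of_colemanMuPackage_of_finite_fineSelmer_of_integralRatio` — `X5.O1.KatoMuPartAtTwo W′` at ONE curve
  (any image) from: the span-free package for all data of `W′`, «`Sel₀(W′/ℚ_∞)[2]` finite», and «`0 ≤ ord₂ ϖ` for every
  newform/ratio of `W′`».
* `katoMuPartOff514_of_colemanMuPackage_of_finite_fineSelmer_optimal` /
  `ordKatoMuPartOptimalAtTwo_of_colemanMuPackage_of_finite_fineSelmer_optimal` — **B7′ = child 23921 BY NAME ⟸ Abbes–Ullmo
  + modularity + TWO binders AT THE OPTIMAL MEMBER of every non-CM good-ordinary class with `ρ̄₂` not onto**: (Colμ-opt) the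
  span-free Coleman `μ`-package (zeta or half classes in Coleman coordinates: `s·G ∈ col(Z)`, `s ∉ (2)`, `ι G = L₂(f, α)`;
  a READING of Kato §§12–17 at `2` at the optimal member — MEMO-7 (1.1)–(1.3) keys it at the Kato-optimal member `E•`,
  whose relation to the `X₀(N)`-optimal `E₀` is MEMO-7 (b)'s Manin/`c_∞` bookkeeping; nothing asserted) and (A₂-opt)
  «`Sel₀(E₀/ℚ_∞, E[2^∞])[2]` finite» (Coates–Sujatha Conjecture A at `2`, Greenberg's `Sel₀[p]`-form; MEMO-7 Props. 2.3/2.4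
  give the Weber / Ferrero–Washington road for reducible resp. `C₃` images; nothing asserted). UNIFORM IN THE IMAGE: no
  `E[2]`-irreducible / reducible split, no Prop-5.14 datum, no member choice.

What this is NOT: not a proof of either binder; B7′ stays OPEN; no census number moves (kit 0 in this seat).

References: [Kato2004Asterisque] §17.13 (pp. 279–280); [GreenbergLNM1716] §1 p. 60, p. 170, Conj. 1.11; [CoatesSujatha2005]
Conj. A; [Washington1997] §13.2; [AbbesUllmo1996] Thm. A; [EdixhovenManin1991] Prop. 2; [MazurTateTeitelbaum1986Invent] §I.12;
MEMO-7 (HOME); pen RC-386/RC-387/RC-388; the line's files p678187, p682426, p692385.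
-/

set_option autoImplicit false
set_option linter.dupNamespace false

noncomputable section

open scoped Classical MatrixGroups ModularForm NumberField
open CongruenceSubgroup WeierstrassCurve Field IsDedekindDomain NumberField
open Literature.NumberTheory.GaloisRepresentations
open Literature.NumberTheory.GaloisCohomology
open Literature.NumberTheory.EllipticCurves Literature.NumberTheory.EllipticCurves.ModularForms
open Literature.NumberTheory.EllipticCurves.Kato2004
  Literature.NumberTheory.EllipticCurves.Kato2004.EulerSystemValues
open Literature.NumberTheory.EllipticCurves.Rank1Residual
open Literature.NumberTheory.EllipticCurves.Greenberg1999
open Summit.BirchSwinnertonDyer.BirchSwinnertonDyer.Theorems.Rank1ResidualX1Defs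
  Summit.BirchSwinnertonDyer.BirchSwinnertonDyer.Rank1Residual
  Summit.BirchSwinnertonDyer.BirchSwinnertonDyer.Rank1Residual.CoreAssembly
open Summit.BirchSwinnertonDyer.Rank1Residual Summit.BirchSwinnertonDyer.Rank1Residual.X5
  Summit.BirchSwinnertonDyer.Rank1Residual.X1.MuLambda
open Summit.BirchSwinnertonDyer.BirchSwinnertonDyer.Theorems.OrdKatoOptimalAtTwo
  Summit.BirchSwinnertonDyer.BirchSwinnertonDyer.Theorems.OrdKatoIntAtTwo
open Summit.BirchSwinnertonDyer.BirchSwinnertonDyer.Theses.ByReductionTypeAtTwo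

namespace Summit.BirchSwinnertonDyer.BirchSwinnertonDyer.Theorems.SteinbergFibreAtTwo

/-! ## §1 `length_(p)(Λ/(G)) = μ(G)` -/

/-- **The local length of `Λ/(G)` at the height-one prime `(p)` is the exact power of `p` dividing `G`** (`G ≠ 0`):
`G = p^{μ(G)}·G♭` with `G♭ ∉ (p)` (`X1.MuLambda.eq_C_pow_mu_mul_pfree`, `red_pfree_ne_zero`), additivity of the local
length over `(ab) ⊆ (a)` (`Module.lengthAt_quotient_span_singleton_mul`), `length_(p)(Λ/(p^μ)) = μ`
(`lengthAt_quotient_C_pow`, height one by `height_augIdealP_holds`) and `length_(p)(Λ/(G♭)) = 0`.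
[cite: Washington1997, §13.2] -/
theorem lengthAt_augIdealP_quotient_span_singleton_eq_mu {p : ℕ} [Fact p.Prime] {G : IwasawaAlgebra p} (hG : G ≠ 0)
    (𝔭 : PrimeSpectrum (IwasawaAlgebra p)) (h𝔭 : 𝔭.asIdeal = IwasawaAlgebra.augIdealP p) :
    Module.lengthAt (IwasawaAlgebra p) (IwasawaAlgebra p ⧸ Ideal.span {G}) 𝔭 = mu G := by
  have hht : 𝔭.asIdeal.height = 1 := by rw [h𝔭]; exact IwasawaAlgebra.height_augIdealP_holds p
  have hfac := eq_C_pow_mu_mul_pfree G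
  have hC0 : (PowerSeries.C ((p : ℤ_[p]) ^ mu G) : IwasawaAlgebra p) ≠ 0 := C_pow_ne_zero (mu G)
  -- `(p^μ) ∈ 𝔭`, `G♭ ∉ 𝔭`
  have hpmem : (PowerSeries.C (p : ℤ_[p]) : IwasawaAlgebra p) ∈ 𝔭.asIdeal := by
    rw [h𝔭, IwasawaAlgebra.augIdealP]; exact Ideal.mem_span_singleton_self _
  have hflat : ¬ Ideal.span {pfree G} ≤ 𝔭.asIdeal := by
    intro hle
    have hmem : pfree G ∈ 𝔭.asIdeal := hle (Ideal.subset_span rfl)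
    rw [h𝔭, IwasawaAlgebra.augIdealP, Ideal.mem_span_singleton] at hmem
    exact red_pfree_ne_zero hG ((red_eq_zero_iff _).mpr hmem)
  calc Module.lengthAt (IwasawaAlgebra p) (IwasawaAlgebra p ⧸ Ideal.span {G}) 𝔭
      = Module.lengthAt (IwasawaAlgebra p)
          (IwasawaAlgebra p ⧸ Ideal.span {PowerSeries.C ((p : ℤ_[p]) ^ mu G) * pfree G}) 𝔭 := by
        rw [← hfac]
    _ = Module.lengthAt (IwasawaAlgebra p) (IwasawaAlgebra p ⧸ Ideal.span {PowerSeries.C ((p : ℤ_[p]) ^ mu G)}) 𝔭 +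
          Module.lengthAt (IwasawaAlgebra p) (IwasawaAlgebra p ⧸ Ideal.span {pfree G}) 𝔭 :=
        Module.lengthAt_quotient_span_singleton_mul _ hC0 𝔭
    _ = mu G := by
        rw [lengthAt_quotient_C_pow (mu G) 𝔭 hht, if_pos hpmem,
          Module.lengthAt_quotient_eq_zero_of_not_le hflat, add_zero]
        simp

/-! ## §2 Per datum: the `μ`-door WITH SLACK -/

section PerDatum

variable {W : WeierstrassCurve ℚ} [W.IsElliptic] [W.IsGloballyMinimal]
  {κ : ZpExtension ℚ 2} {γ : absoluteGaloisGroup ℚ}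
  {D : W.SelmerDualData κ γ} {Y : W.FineSelmerDualData κ γ}

omit [W.IsGloballyMinimal] in
/-- **THE `μ`-DOOR WITH SLACK (KERNEL; span-free, image-free).** For the cyclotomic `(κ, γ)`, a Selmer dual datum `D`
(`X`) and a fine Selmer dual datum `Y` (`X₀`): an ideal `P ⊆ Λ`, `M ⊆ P`, `τ : P → X` killing `M`, `π : X ↠ X₀` exact after
`τ`, `G ≠ 0` and `s ∉ (2)` with `s·G ∈ M`; if `Sel₀(ℚ_∞, E[2^∞])[2]` is finite then `μ(X) ≤ μ(G)`. Proof: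
`length_(2) X ≤ length_(2)(P/M) + length_(2) X₀`, `length_(2) X₀ = 0` (`X₀/2X₀` finite), `length_(2)(P/M) ≤
length_(2)(Λ/M) ≤ length_(2)(Λ/(s·G)) = length_(2)(Λ/(s)) + length_(2)(Λ/(G)) = 0 + μ(G)`. No newform, no image, no `𝐇¹`.
[cite: Kato2004Asterisque, §17.13 (pp. 279–280) (shape of the sequence)] [cite: GreenbergLNM1716, §1 p. 60 (after Conj. 1.3)]
[cite: Washington1997, §13.2] -/
theorem mu_le_mu_of_unitMultiple_of_exact_of_finite_fineSelmer_pTorsion (hκ : κ.IsCyclotomic)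
    (hγ : κ.IsTopGenerator γ) {G : IwasawaAlgebra 2} (hG : G ≠ 0)
    (P : Submodule (IwasawaAlgebra 2) (IwasawaAlgebra 2)) (M : Submodule (IwasawaAlgebra 2) P)
    (τ : P →ₗ[IwasawaAlgebra 2] D.X) (π : D.X →ₗ[IwasawaAlgebra 2] Y.X)
    (hτM : ∀ m ∈ M, τ m = 0) (hπs : Function.Surjective π) (hπ : Function.Exact τ π)
    (himg : ∃ s : IwasawaAlgebra 2, s ∉ IwasawaAlgebra.augIdealP 2 ∧ s * G ∈ Submodule.map P.subtype M)
    (hfin : Set.Finite {s : W.fineSelmerInfty κ | 2 • s = 0}) : D.mu ≤ mu G := by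
  -- `X(E/ℚ_∞)` is finitely generated over `Λ` for the cyclotomic `κ` (PROVED in the tree, Nakayama)
  haveI : Module.Finite (IwasawaAlgebra 2) D.X :=
    WeierstrassCurve.SelmerDualData.module_finite_of_isCyclotomic W κ hκ D hγ
  haveI : Module.Finite (IwasawaAlgebra 2) Y.X := Module.Finite.of_surjective π hπs
  obtain ⟨s, hs, hsGM⟩ := himg
  have hs0 : s ≠ 0 := by rintro rfl; exact hs (Submodule.zero_mem _)
  -- `Sel₀(E/ℚ_∞)[2]` finite (displayed) ⇒ `X₀/2X₀` finite
  haveI : Finite (Y.X ⧸ (IwasawaAlgebra.augIdealP 2 • (⊤ : Submodule (IwasawaAlgebra 2) Y.X))) :=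
    Y.finite_quotient_augIdealP_of_finite_pTorsion hfin
  let 𝔭 : PrimeSpectrum (IwasawaAlgebra 2) :=
    ⟨IwasawaAlgebra.augIdealP 2, IwasawaAlgebra.isPrime_augIdealP_holds 2⟩
  have hY0 : Module.lengthAt (IwasawaAlgebra 2) Y.X 𝔭 = 0 :=
    KatoMuSkeleton.lengthAt_eq_zero_of_finite_quotient_p (M := Y.X) 𝔭 rfl
  -- `length_(2)(Λ/(s·G)) = μ(G)`
  have hsG : Module.lengthAt (IwasawaAlgebra 2) (IwasawaAlgebra 2 ⧸ Ideal.span {s * G}) 𝔭 = mu G := by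
    rw [Module.lengthAt_quotient_span_singleton_mul G hs0 𝔭,
      Module.lengthAt_quotient_eq_zero_of_not_le (I := Ideal.span {s})
        (by rwa [Ideal.span_singleton_le_iff_mem]), zero_add,
      lengthAt_augIdealP_quotient_span_singleton_eq_mu hG 𝔭 rfl]
  have hX : Module.lengthAt (IwasawaAlgebra 2) D.X 𝔭 ≤ mu G := by
    set M' : Ideal (IwasawaAlgebra 2) := Submodule.map P.subtype M with hM'
    -- `Λ/(s·G) ↠ Λ/M'`
    have hspan : Ideal.span {s * G} ≤ M' := by
      rw [Ideal.span_singleton_le_iff_mem]; exact hsGM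
    have hΛM : Module.lengthAt (IwasawaAlgebra 2) (IwasawaAlgebra 2 ⧸ M') 𝔭 ≤ mu G := by
      rw [← hsG]
      exact Module.lengthAt_le_of_surjective (Submodule.factor hspan) (Submodule.factor_surjective hspan) 𝔭
    -- `P/M ↪ Λ/M'`
    have hPM : Module.lengthAt (IwasawaAlgebra 2) (P ⧸ M) 𝔭 ≤ mu G := by
      refine le_trans ?_ hΛM
      refine Module.lengthAt_le_of_injective (Submodule.mapQ M M' P.subtype fun y hy => ⟨y, hy, rfl⟩) ?_ 𝔭
      rw [← LinearMap.ker_eq_bot, Submodule.ker_mapQ, hM',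
        Submodule.comap_map_eq_of_injective P.injective_subtype, Submodule.mkQ_map_self]
    -- `P/M → X ↠ X₀`
    have hle : M ≤ LinearMap.ker τ := fun m hm => hτM m hm
    let f' : (P ⧸ M) →ₗ[IwasawaAlgebra 2] D.X := M.liftQ τ hle
    have hf' : Function.Exact f' π := by
      rw [LinearMap.exact_iff, Submodule.range_liftQ]
      exact LinearMap.exact_iff.mp hπ
    calc Module.lengthAt (IwasawaAlgebra 2) D.X 𝔭
        ≤ Module.lengthAt (IwasawaAlgebra 2) (P ⧸ M) 𝔭 + Module.lengthAt (IwasawaAlgebra 2) Y.X 𝔭 :=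
          Module.lengthAt_le_add_of_exact f' π hf' 𝔭
      _ ≤ mu G := by rw [hY0, add_zero]; exact hPM
  change muInvariant 2 D.X ≤ mu G
  rw [muInvariant_eq_toNat_lengthAt 2 D.X 𝔭 rfl]
  exact_mod_cast (ENat.coe_toNat_le_self _).trans hX

end PerDatum

/-! ## §3 Kato's `μ`-part at ONE curve from the package, Conjecture A₂ and an integral Néron ratio -/

/-- **`X5.O1.KatoMuPartAtTwo W′` at ONE curve — ANY image of `ρ̄₂`** — from: (i) the span-free Coleman `μ`-package for every
newform `f` of `W′`, all cyclotomic data and all dual data (image clause for every `G` with `ι G = L₂(f, α)`); (ii) «`Sel₀(W′/ℚ_∞)[2]`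
finite» for every cyclotomic `κ`; (iii) «`0 ≤ ord₂ ϖ`» for every newform/Néron ratio of `W′`. Then for every integral lift
`L₀` of `ϖ·L₂(f, α)`: `L₀ = ϖ₀·G` (INT2-AUTO `G`, `ι` injective, `ϖ₀ ∈ ℤ₂`) and `2^{μ(X)} ∣ 2^{μ(G)} ∣ G ∣ L₀`
(`mu_le_mu_of_unitMultiple_of_exact_of_finite_fineSelmer_pTorsion`). All three inputs displayed; conditional; nothing asserted.
[cite: GreenbergLNM1716, §1 p. 60, p. 170 (shape)] [cite: Kato2004Asterisque, §17.13 (pp. 279–280)] [cite: MazurTateTeitelbaum1986Invent, §I.12] -/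
theorem katoMuPartAtTwo_of_colemanMuPackage_of_finite_fineSelmer_of_integralRatio (W' : WeierstrassCurve ℚ)
    [W'.IsElliptic] [W'.IsGloballyMinimal]
    (hC : ∀ {N : ℕ} [NeZero N] (f : CuspForm (Gamma0 N) 2) (κ : ZpExtension ℚ 2) (γ : absoluteGaloisGroup ℚ),
      κ.IsCyclotomic → κ.IsTopGenerator γ → IsCyclotomicVariable 2 γ → IsNewformOf W' f →
      ∀ (D : W'.SelmerDualData κ γ) (Y : W'.FineSelmerDualData κ γ),
        ∃ (P : Submodule (IwasawaAlgebra 2) (IwasawaAlgebra 2)) (M : Submodule (IwasawaAlgebra 2) P)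
          (τ : P →ₗ[IwasawaAlgebra 2] D.X) (π : D.X →ₗ[IwasawaAlgebra 2] Y.X),
          (∀ m ∈ M, τ m = 0) ∧ Function.Surjective π ∧ Function.Exact τ π ∧
          ∀ G₁ : IwasawaAlgebra 2, iwasawaToPowerSeries 2 G₁ = padicLFunction f (unitRoot W' 2 : ℚ_[2]) →
            ∃ s : IwasawaAlgebra 2, s ∉ IwasawaAlgebra.augIdealP 2 ∧ s * G₁ ∈ Submodule.map P.subtype M)
    (hA : ∀ κ : ZpExtension ℚ 2, κ.IsCyclotomic → Set.Finite {s : W'.fineSelmerInfty κ | 2 • s = 0})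
    (hϖ : ∀ {N : ℕ} [NeZero N] (f : CuspForm (Gamma0 N) 2), IsNewformOf W' f →
      ∀ ϖ : ℚ, (ϖ : ℝ) * W'.realPeriodRat = plusPeriod f → 0 ≤ padicValRat 2 ϖ) :
    O1.KatoMuPartAtTwo W' := by
  intro κ γ hκ hγ hγ' hord _ f hf ϖ hϖf D L₀ hL₀
  obtain ⟨Y⟩ := W'.nonempty_fineSelmerDualData κ hγ
  obtain ⟨P, M, τ, π, hτM, hπs, hπ, himg⟩ := hC f κ γ hκ hγ hγ' hf D Y
  -- `L₂(f, α) = ι G` (INT2-AUTO) and `L₀ = ϖ₀ · G`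
  obtain ⟨G, hG⟩ := exists_iwasawaToPowerSeries_eq_padicLFunction_two_auto (W := W') (f := f) hord hf
  have hnorm : ‖((ϖ : ℚ) : ℚ_[2])‖ ≤ 1 := by
    by_cases h0 : ϖ = 0
    · subst h0; simp
    have hϖQ : ((ϖ : ℚ) : ℚ_[2]) ≠ 0 := by exact_mod_cast h0
    rw [Padic.norm_eq_zpow_neg_valuation hϖQ, Padic.valuation_ratCast]
    exact zpow_le_one_of_nonpos₀ (by norm_num) (by linarith [hϖ f hf ϖ hϖf])
  let ϖ₀ : ℤ_[2] := ⟨((ϖ : ℚ) : ℚ_[2]), hnorm⟩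
  have hL₀G : L₀ = (PowerSeries.C ϖ₀ : IwasawaAlgebra 2) * G := by
    apply iwasawaToPowerSeries_injective 2
    rw [hL₀, map_mul, hG, iwasawaToPowerSeries, PowerSeries.map_C]
    rfl
  by_cases hG0 : G = 0
  · rw [hL₀G, hG0, mul_zero]; exact dvd_zero _
  -- `μ(X) ≤ μ(G)` and `2^{μ(X)} ∣ 2^{μ(G)} ∣ G ∣ L₀`
  have hμ : D.mu ≤ mu G :=
    mu_le_mu_of_unitMultiple_of_exact_of_finite_fineSelmer_pTorsion hκ hγ hG0 P M τ π hτM hπs hπ (himg G hG) (hA κ hκ)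
  calc (PowerSeries.C (((2 : ℕ) : ℤ_[2]) ^ D.mu) : IwasawaAlgebra 2)
      ∣ PowerSeries.C (((2 : ℕ) : ℤ_[2]) ^ mu G) := map_dvd _ (pow_dvd_pow _ hμ)
    _ ∣ G := C_pow_mu_dvd hG0
    _ ∣ L₀ := by rw [hL₀G]; exact dvd_mul_left _ _

/-! ## §4 B7′ BY NAME from {Coleman `μ`-package, Conjecture A₂} AT THE OPTIMAL MEMBER -/

/-- **B7′ `KatoMuPartOff514AtOptimalMemberOfNotSurjectiveTwo` (child stmt-BirchSwinnertonDyer-23921) BY NAME ⟸ Abbes–Ullmo +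
modularity + TWO binders AT THE OPTIMAL MEMBER, UNIFORMLY IN THE IMAGE.** For every non-CM globally minimal `W`, good
ordinary at `2`, with `ρ̄_{W,2}` NOT onto, and every isogenous lattice-optimal `W₀` (datum `D₀`, `Λ_{W₀} = c₀·Λ_f`):
(Colμ-opt) `hC` — the span-free Coleman `μ`-package for every newform of `W₀`, all cyclotomic and dual data; (A₂-opt) `hA` —
«`Sel₀(W₀/ℚ_∞, E[2^∞])[2]` finite» for every cyclotomic `κ`. Then B7′: the witness is `W₀` (p692385
`katoMuPartOff514_of_optimalMember`, left disjunct), its `μ`-part is `katoMuPartAtTwo_of_colemanMuPackage_of_finite_fineSelmer_of_integralRatio`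
with the Néron ratio a `2`-adic unit at `W₀` (p692385 `padicValRat_two_neronRatio_eq_zero_of_latticeOptimal_of_abbesUllmo`). No
`E[2]`-irreducible/reducible split, no Prop-5.14 datum. Conditional; nothing closed.
[cite: AbbesUllmo1996, Thm. A] [cite: EdixhovenManin1991, Prop. 2] [cite: GreenbergLNM1716, §1 p. 60, Conj. 1.11 (shape)]
[cite: Kato2004Asterisque, §17.13 (pp. 279–280)] -/
theorem katoMuPartOff514_of_colemanMuPackage_of_finite_fineSelmer_optimal
    (hAU : abbesUllmo_not_dvd_maninConstant_of_not_dvd_level) (hMod : nonempty_modularParametrizationData)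
    (hC : ∀ (W : WeierstrassCurve ℚ) [W.IsElliptic] [W.IsGloballyMinimal],
      ¬ W.HasCM → GoodOrd W 2 → ¬ W.HasSurjectiveModNGaloisRep 2 →
      ∀ (W₀ : WeierstrassCurve ℚ) [W₀.IsElliptic] [W₀.IsGloballyMinimal] {N₀ : ℕ} [NeZero N₀]
        (D₀ : ModularParametrizationData W₀ N₀), WeierstrassCurve.IsIsogenous W W₀ →
        (∀ z ∈ D₀.L.lattice, ∃ w ∈ periodLattice D₀.f, z = D₀.c * w) →
      ∀ {N : ℕ} [NeZero N] (f : CuspForm (Gamma0 N) 2) (κ : ZpExtension ℚ 2) (γ : absoluteGaloisGroup ℚ),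
        κ.IsCyclotomic → κ.IsTopGenerator γ → IsCyclotomicVariable 2 γ → IsNewformOf W₀ f →
        ∀ (D : W₀.SelmerDualData κ γ) (Y : W₀.FineSelmerDualData κ γ),
          ∃ (P : Submodule (IwasawaAlgebra 2) (IwasawaAlgebra 2)) (M : Submodule (IwasawaAlgebra 2) P)
            (τ : P →ₗ[IwasawaAlgebra 2] D.X) (π : D.X →ₗ[IwasawaAlgebra 2] Y.X),
            (∀ m ∈ M, τ m = 0) ∧ Function.Surjective π ∧ Function.Exact τ π ∧
            ∀ G₁ : IwasawaAlgebra 2, iwasawaToPowerSeries 2 G₁ = padicLFunction f (unitRoot W₀ 2 : ℚ_[2]) →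
              ∃ s : IwasawaAlgebra 2, s ∉ IwasawaAlgebra.augIdealP 2 ∧ s * G₁ ∈ Submodule.map P.subtype M)
    (hA : ∀ (W : WeierstrassCurve ℚ) [W.IsElliptic] [W.IsGloballyMinimal],
      ¬ W.HasCM → GoodOrd W 2 → ¬ W.HasSurjectiveModNGaloisRep 2 →
      ∀ (W₀ : WeierstrassCurve ℚ) [W₀.IsElliptic] [W₀.IsGloballyMinimal] {N₀ : ℕ} [NeZero N₀]
        (D₀ : ModularParametrizationData W₀ N₀), WeierstrassCurve.IsIsogenous W W₀ →
        (∀ z ∈ D₀.L.lattice, ∃ w ∈ periodLattice D₀.f, z = D₀.c * w) →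
        ∀ κ : ZpExtension ℚ 2, κ.IsCyclotomic → Set.Finite {s : W₀.fineSelmerInfty κ | 2 • s = 0}) :
    KatoMuPartOff514AtOptimalMemberOfNotSurjectiveTwo := by
  refine katoMuPartOff514_of_optimalMember hAU hMod ?_
  intro W _ _ hcm hgo hns W₀ _ _ N₀ _ D₀ hiso hopt
  exact Or.inl <| katoMuPartAtTwo_of_colemanMuPackage_of_finite_fineSelmer_of_integralRatio W₀
    (fun f κ γ hκ hγ hγ' hf D Y ↦ hC W hcm hgo hns W₀ D₀ hiso hopt f κ γ hκ hγ hγ' hf D Y)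
    (hA W hcm hgo hns W₀ D₀ hiso hopt)
    (fun f hf ϖ hϖ ↦ (padicValRat_two_neronRatio_eq_zero_of_latticeOptimal_of_abbesUllmo hAU W₀
      (goodOrd_two_of_isIsogenous W hiso hgo).1 D₀ hopt f hf ϖ hϖ).ge)

/-- **The route's child `OrdKatoMuPartOptimalAtTwo` (stmt-BirchSwinnertonDyer-23921, text = B7′ verbatim) BY NAME from Abbes–Ullmo,
modularity and the two optimal-member binders (Colμ-opt), (A₂-opt).** Conditional; the item is NOT closed by this; nothing
asserted. [cite: AbbesUllmo1996, Thm. A] [cite: EdixhovenManin1991, Prop. 2] [cite: GreenbergLNM1716, §1 p. 60, Conj. 1.11 (shape)] -/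
theorem ordKatoMuPartOptimalAtTwo_of_colemanMuPackage_of_finite_fineSelmer_optimal
    (hAU : abbesUllmo_not_dvd_maninConstant_of_not_dvd_level) (hMod : nonempty_modularParametrizationData)
    (hC : ∀ (W : WeierstrassCurve ℚ) [W.IsElliptic] [W.IsGloballyMinimal],
      ¬ W.HasCM → GoodOrd W 2 → ¬ W.HasSurjectiveModNGaloisRep 2 →
      ∀ (W₀ : WeierstrassCurve ℚ) [W₀.IsElliptic] [W₀.IsGloballyMinimal] {N₀ : ℕ} [NeZero N₀]
        (D₀ : ModularParametrizationData W₀ N₀), WeierstrassCurve.IsIsogenous W W₀ →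
        (∀ z ∈ D₀.L.lattice, ∃ w ∈ periodLattice D₀.f, z = D₀.c * w) →
      ∀ {N : ℕ} [NeZero N] (f : CuspForm (Gamma0 N) 2) (κ : ZpExtension ℚ 2) (γ : absoluteGaloisGroup ℚ),
        κ.IsCyclotomic → κ.IsTopGenerator γ → IsCyclotomicVariable 2 γ → IsNewformOf W₀ f →
        ∀ (D : W₀.SelmerDualData κ γ) (Y : W₀.FineSelmerDualData κ γ),
          ∃ (P : Submodule (IwasawaAlgebra 2) (IwasawaAlgebra 2)) (M : Submodule (IwasawaAlgebra 2) P)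
            (τ : P →ₗ[IwasawaAlgebra 2] D.X) (π : D.X →ₗ[IwasawaAlgebra 2] Y.X),
            (∀ m ∈ M, τ m = 0) ∧ Function.Surjective π ∧ Function.Exact τ π ∧
            ∀ G₁ : IwasawaAlgebra 2, iwasawaToPowerSeries 2 G₁ = padicLFunction f (unitRoot W₀ 2 : ℚ_[2]) →
              ∃ s : IwasawaAlgebra 2, s ∉ IwasawaAlgebra.augIdealP 2 ∧ s * G₁ ∈ Submodule.map P.subtype M)
    (hA : ∀ (W : WeierstrassCurve ℚ) [W.IsElliptic] [W.IsGloballyMinimal],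
      ¬ W.HasCM → GoodOrd W 2 → ¬ W.HasSurjectiveModNGaloisRep 2 →
      ∀ (W₀ : WeierstrassCurve ℚ) [W₀.IsElliptic] [W₀.IsGloballyMinimal] {N₀ : ℕ} [NeZero N₀]
        (D₀ : ModularParametrizationData W₀ N₀), WeierstrassCurve.IsIsogenous W W₀ →
        (∀ z ∈ D₀.L.lattice, ∃ w ∈ periodLattice D₀.f, z = D₀.c * w) →
        ∀ κ : ZpExtension ℚ 2, κ.IsCyclotomic → Set.Finite {s : W₀.fineSelmerInfty κ | 2 • s = 0}) :
    OrdKatoMuPartOptimalAtTwo :=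
  katoMuPartOff514_of_colemanMuPackage_of_finite_fineSelmer_optimal hAU hMod hC hA

end Summit.BirchSwinnertonDyer.BirchSwinnertonDyer.Theorems.SteinbergFibreAtTwo

end
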